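import Summits.CriticalPhenomena.Ising3DConformalLimit.Theorems.PrecisionLaplacianInverseMCriticalKernelFiniteGraph
import Literature.LinearAlgebra.Matrix.InverseMMatrixProofs
import Literature.Probability.LatticeModels.SharpnessProofs
import Literature.Probability.LatticeModels.IsingTransport
import Literature.Probability.LatticeModels.TorusTwoPointLimit
import Literature.Probability.LatticeModels.CriticalTwoPointBounds
import Literature.Probability.LatticeModels.IsingTranslationInvariance
import HarnessLib

/-!
# The critical kernel of `ℤ³` is a symmetric potential (support item `InverseMCriticalKernel`,
# route `PrecisionLaplacian` of `CriticalPhenomena/Ising3DConformalLimit`)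

`InverseMCriticalKernel_proof : InverseMCriticalKernel`, i.e.
`InverseMFerromagnet →` for every finite `A ⊂ ℤ³` the matrix
`G_A := (criticalTwoPoint 3 (q - p))_{p,q ∈ A}` is positive definite and `(G_A)⁻¹` has nonpositive
off-diagonal entries and nonnegative row sums.

## Proof (the route's sketch, card M4)

1. **Torus approximants are potential matrices** (`torus_isPotentialMatrix`). On the torus
   `𝕋_N = (ℤ/Nℤ)^d` at `β ≥ 0`, zero field, the two-point matrix `Σ_N = (⟨σ_xσ_y⟩_{𝕋_N;β})` is
   entrywise `≥ 0` (GKS I), positive definite with the UNIFORM bound `cᵀΣ_N c ≥ e^{-4βd} c_p²`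
   (finite energy, `finiteEnergy_quadratic_lower_bound` of the helper file, degree `≤ 2d`), its
   inverse is a Z-matrix by the route hypothesis `InverseMFerromagnet` transported to the torus graph
   (`isZMatrix_inv_twoPoint_of_inverseMFerromagnet`), and translation invariance
   (`isingTorusTwoPoint_add_right`) gives constant row sums `χ_N`, whence `Σ_N⁻¹𝟙 = 𝟙/χ_N ≥ 0`.
2. **Principal submatrices** (`eventually_submatrix_isPotentialMatrix`): for `N = n + 1 > 2L₀`
   (`A ⊆ Λ_{L₀}`) the projection `A → 𝕋_N` is injective and `G_A^{(n)} := (Σ_N)_{Ā}` is a potential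
   matrix by Dellacherie–Martínez–San Martín 2014, Lemma 2.32
   (`Literature.LinearAlgebra.Matrix.principalSubmatrix_closure_holds`), with the same uniform
   quadratic lower bound (push the coefficient vector forward to the torus).
3. **Limit** (`tendsto_isingTorusTwoPoint_criticalTwoPoint`): `G_A^{(n)} → G_A` entrywise, by the
   tree's torus/box Griffiths sandwich at `m*(β_c) = 0`
   (`abs_isingTorusTwoPoint_sub_plusCorr_le_of_spontaneousMagnetization_eq_zero`,
   `spontaneousMagnetization_criticalBeta_eq_zero_holds` — Aizenman–Duminil-Copin–Sidoravicius 2015,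
   `d ≥ 3`) and translation invariance of the plus state (`plusCorr_shift`,
   `twoPointPlus_eq_plusCorr`). Hence `G_A` is symmetric and `cᵀG_A c ≥ e^{-4β_c d} c_p² > 0`
   (`posDef_criticalTwoPoint_submatrix`), so `det G_A ≠ 0`, matrix inversion is continuous at `G_A`
   (`continuousAt_matrix_inv`), `(G_A^{(n)})⁻¹ → G_A⁻¹` entrywise
   (`tendsto_inv_submatrix_criticalTwoPoint`), and the closed sign conditions pass to the limit
   (`criticalTwoPoint_isSymmetricPotential`, any `d ≥ 3`; the item is `d = 3`).

References: Dellacherie–Martínez–San Martín, *Inverse M-matrices and ultrametric matrices*, LNM 2118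
(2014), ch. 2, Lemma 2.32; Friedli–Velenik 2017, §3.1, §3.8.1, Exercise 3.12; Aizenman–Duminil-Copin
2021, Prop. 5.2; Aizenman–Duminil-Copin–Sidoravicius 2015, Thm. 1.2.
-/

namespace Summit.CriticalPhenomena.Ising3DConformalLimit.Theorems

open Literature.Probability.LatticeModels Literature.LinearAlgebra.Matrix Finset
open Summit.CriticalPhenomena.Ising3DConformalLimit.Theses.PrecisionLaplacian
open scoped Matrix

noncomputable section

/-! ## The torus two-point matrix is a potential matrix (given IM) -/

section Torus

variable {d N : ℕ} [NeZero N]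

/-- Every site of the discrete torus `(ℤ/Nℤ)^d` has at most `2d` neighbours (`x ± eᵢ`). -/
theorem torusGraph_degree_le (x : TorusSite d N) : (torusGraph d N).degree x ≤ 2 * d := by
  classical
  have hsub : (torusGraph d N).neighborFinset x ⊆
      (univ : Finset (Fin d × Bool)).image fun ib =>
        if ib.2 then x + Pi.single ib.1 1 else x - Pi.single ib.1 1 := by
    intro y hy
    rw [SimpleGraph.mem_neighborFinset, torusGraph_adj_iff] at hy
    obtain ⟨-, ⟨i, h⟩ | ⟨i, h⟩⟩ := hy
    · exact Finset.mem_image.2 ⟨(i, true), Finset.mem_univ _, by simp [h]⟩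
    · exact Finset.mem_image.2 ⟨(i, false), Finset.mem_univ _, by simp [h]⟩
  calc (torusGraph d N).degree x = #((torusGraph d N).neighborFinset x) :=
        (SimpleGraph.card_neighborFinset_eq_degree _ _).symm
    _ ≤ #((univ : Finset (Fin d × Bool)).image fun ib =>
          if ib.2 then x + Pi.single ib.1 1 else x - Pi.single ib.1 1) := Finset.card_le_card hsub
    _ ≤ #(univ : Finset (Fin d × Bool)) := Finset.card_image_le
    _ = 2 * d := by simp [Finset.card_univ, mul_comm]

/-- **Finite energy on the torus**: for `β ≥ 0` and every `c`, `p`,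
`e^{-4βd} c_p² ≤ ∑_{x,y} c_x c_y ⟨σ_xσ_y⟩_{𝕋_N;β}` (degree `≤ 2d` in
`finiteEnergy_quadratic_lower_bound`). -/
theorem torus_quadratic_lower_bound {β : ℝ} (hβ : 0 ≤ β) (c : TorusSite d N → ℝ)
    (p : TorusSite d N) :
    Real.exp (-(2 * β * (2 * d : ℕ))) * c p ^ 2 ≤
      ∑ x, ∑ y, c x * c y * isingTorusTwoPoint d N β 0 x y :=
  finiteEnergy_quadratic_lower_bound (torusGraph d N) hβ p (torusGraph_degree_le p) c

/-- The quadratic form of the torus two-point matrix: `c ⬝ (Σ_N c) = ∑_{x,y} c_x c_y ⟨σ_xσ_y⟩`. -/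
theorem torus_dotProduct_mulVec (β : ℝ) (c : TorusSite d N → ℝ) :
    c ⬝ᵥ ((Matrix.of fun x y : TorusSite d N => isingTorusTwoPoint d N β 0 x y) *ᵥ c) =
      ∑ x, ∑ y, c x * c y * isingTorusTwoPoint d N β 0 x y := by
  simp only [dotProduct, Matrix.mulVec, Matrix.of_apply, Finset.mul_sum]
  refine Finset.sum_congr rfl fun x _ => Finset.sum_congr rfl fun y _ => ?_
  ring

/-- **The torus two-point matrix `Σ_N = (⟨σ_xσ_y⟩_{𝕋_N;β})` is positive definite** (`β ≥ 0`):
symmetric, and `cᵀΣ_N c ≥ e^{-4βd} c_p² > 0` at any `p` with `c_p ≠ 0`. -/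
theorem torus_posDef {β : ℝ} (hβ : 0 ≤ β) :
    (Matrix.of fun x y : TorusSite d N => isingTorusTwoPoint d N β 0 x y).PosDef := by
  refine Matrix.PosDef.of_dotProduct_mulVec_pos ?_ fun c hc => ?_
  · exact Matrix.IsHermitian.ext fun i j => by
      simp only [Matrix.of_apply, star_trivial]
      exact isingTorusTwoPoint_comm β 0 j i
  · obtain ⟨p, hp⟩ := Function.ne_iff.1 hc
    rw [star_trivial, torus_dotProduct_mulVec]
    refine lt_of_lt_of_le ?_ (torus_quadratic_lower_bound hβ c p)
    exact mul_pos (Real.exp_pos _) (lt_of_le_of_ne (sq_nonneg _) (Ne.symm (pow_ne_zero 2 hp)))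

/-- `0 ≤ ⟨σ_xσ_y⟩_{𝕋_N;β}` for `β ≥ 0` (Griffiths' first inequality; `= 1` on the diagonal). -/
theorem torus_twoPoint_nonneg {β : ℝ} (hβ : 0 ≤ β) (x y : TorusSite d N) :
    0 ≤ isingTorusTwoPoint d N β 0 x y := by
  rcases eq_or_ne x y with rfl | hxy
  · simp [isingTorusTwoPoint]
  · rw [isingTorusTwoPoint, isingTwoPoint_eq_isingCorr _ _ _ _ _ hxy]
    exact GKSInequalities.gks_one_holds (torusGraph d N) hβ le_rfl (Or.inl rfl)
      (Finset.subset_univ _)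

/-- Translation invariance makes the row sums of `Σ_N` constant:
`∑_y ⟨σ_xσ_y⟩_{𝕋_N} = ∑_y ⟨σ_0σ_y⟩_{𝕋_N} =: χ_N` for every `x`. -/
theorem torus_rowSum_eq (β h : ℝ) (x : TorusSite d N) :
    ∑ y, isingTorusTwoPoint d N β h x y = ∑ y, isingTorusTwoPoint d N β h 0 y := by
  have h1 : ∀ y, isingTorusTwoPoint d N β h x y = isingTorusTwoPoint d N β h 0 (y + -x) := by
    intro y
    rw [← isingTorusTwoPoint_add_right β h (-x) x y, add_neg_cancel]
  simp only [h1]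
  exact Equiv.sum_comp (Equiv.addRight (-x)) (fun y => isingTorusTwoPoint d N β h 0 y)

/-- The finite-volume susceptibility `χ_N = ∑_y ⟨σ_0σ_y⟩_{𝕋_N;β} ≥ ⟨σ_0σ_0⟩ = 1 > 0` (`β ≥ 0`). -/
theorem torus_rowSum_pos {β : ℝ} (hβ : 0 ≤ β) :
    0 < ∑ y, isingTorusTwoPoint d N β 0 (0 : TorusSite d N) y := by
  have h1 : isingTorusTwoPoint d N β 0 (0 : TorusSite d N) 0 = 1 := by simp [isingTorusTwoPoint]
  calc (0 : ℝ) < 1 := one_pos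
    _ = isingTorusTwoPoint d N β 0 (0 : TorusSite d N) 0 := h1.symm
    _ ≤ ∑ y, isingTorusTwoPoint d N β 0 (0 : TorusSite d N) y :=
        Finset.single_le_sum (f := fun y => isingTorusTwoPoint d N β 0 (0 : TorusSite d N) y)
          (fun y _ => torus_twoPoint_nonneg hβ 0 y) (Finset.mem_univ _)

/-- **Row sums of `Σ_N⁻¹` are `1/χ_N ≥ 0`.** Since `Σ_N 𝟙 = χ_N 𝟙` (constant row sums) and `Σ_N`
is nonsingular (positive definite), `Σ_N⁻¹ 𝟙 = χ_N⁻¹ 𝟙`. -/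
theorem torus_inv_rowSum_eq {β : ℝ} (hβ : 0 ≤ β) (i : TorusSite d N) :
    ∑ j, (Matrix.of fun x y : TorusSite d N => isingTorusTwoPoint d N β 0 x y)⁻¹ i j =
      (∑ y, isingTorusTwoPoint d N β 0 (0 : TorusSite d N) y)⁻¹ := by
  set M : Matrix (TorusSite d N) (TorusSite d N) ℝ :=
    Matrix.of fun x y : TorusSite d N => isingTorusTwoPoint d N β 0 x y with hM
  set χ : ℝ := ∑ y, isingTorusTwoPoint d N β 0 (0 : TorusSite d N) y with hχ
  have hχ0 : χ ≠ 0 := (torus_rowSum_pos (d := d) (N := N) hβ).ne'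
  have hM1 : M *ᵥ (1 : TorusSite d N → ℝ) = χ • (1 : TorusSite d N → ℝ) := by
    funext x
    simp only [Matrix.mulVec, dotProduct, Pi.one_apply, mul_one, Pi.smul_apply, smul_eq_mul, hM,
      Matrix.of_apply]
    exact torus_rowSum_eq β 0 x
  have hdet : IsUnit M.det :=
    (Matrix.isUnit_iff_isUnit_det M).1 (torus_posDef (d := d) (N := N) hβ).isUnit
  have hinv : M⁻¹ *ᵥ (1 : TorusSite d N → ℝ) = χ⁻¹ • (1 : TorusSite d N → ℝ) := by
    have h2 : M⁻¹ *ᵥ (M *ᵥ (1 : TorusSite d N → ℝ)) = (1 : TorusSite d N → ℝ) := by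
      rw [Matrix.mulVec_mulVec, Matrix.nonsing_inv_mul M hdet, Matrix.one_mulVec]
    rw [hM1, Matrix.mulVec_smul] at h2
    calc M⁻¹ *ᵥ (1 : TorusSite d N → ℝ) = χ⁻¹ • (χ • (M⁻¹ *ᵥ (1 : TorusSite d N → ℝ))) := by
          rw [smul_smul, inv_mul_cancel₀ hχ0, one_smul]
      _ = χ⁻¹ • (1 : TorusSite d N → ℝ) := by rw [h2]
  have h3 := congrFun hinv i
  simp only [Matrix.mulVec, dotProduct, Pi.one_apply, mul_one, Pi.smul_apply, smul_eq_mul] at h3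
  exact h3

/-- **The torus two-point matrix is a potential matrix under IM** (Dellacherie–Martínez–San Martín
2014, ch. 2: nonnegative, nonsingular, Z-matrix inverse with nonnegative row sums): entries `≥ 0`
by GKS I, nonsingular by finite energy, `Σ_N⁻¹` a Z-matrix by `InverseMFerromagnet` (applied to the
pair ferromagnet on the torus graph), and `Σ_N⁻¹𝟙 = 𝟙/χ_N ≥ 0` by translation invariance. -/
theorem torus_isPotentialMatrix (hIM : InverseMFerromagnet) {β : ℝ} (hβ : 0 ≤ β) :
    IsPotentialMatrix (Matrix.of fun x y : TorusSite d N => isingTorusTwoPoint d N β 0 x y) := by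
  refine ⟨⟨fun x y => torus_twoPoint_nonneg hβ x y, ?_, ?_⟩, fun i => ?_⟩
  · exact (Matrix.isUnit_iff_isUnit_det _).1 (torus_posDef (d := d) (N := N) hβ).isUnit
  · exact isZMatrix_inv_twoPoint_of_inverseMFerromagnet (torusGraph d N) hIM hβ
  · rw [torus_inv_rowSum_eq hβ i]
    exact inv_nonneg.2 (torus_rowSum_pos (d := d) (N := N) hβ).le

end Torus

/-! ## The thermodynamic limit: the critical kernel of `ℤ^d`, `d ≥ 3`, is a symmetric potential -/

section Limit

open Filter Topology

variable {d : ℕ}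

/-- **Convergence of the periodic two-point function to the critical kernel** (`d ≥ 3`):
`⟨σ_{p̄}σ_{q̄}⟩_{𝕋_{n+1};β_c} → ⟨σ₀σ_{q-p}⟩⁺_{β_c} = criticalTwoPoint d (q - p)` as `n → ∞`.
Ingredients: the torus/box sandwich at `m*(β_c) = 0` (Aizenman–Duminil-Copin–Sidoravicius 2015,
`spontaneousMagnetization_criticalBeta_eq_zero_holds`;
`abs_isingTorusTwoPoint_sub_plusCorr_le_of_spontaneousMagnetization_eq_zero`) and translation
invariance of the plus state (`plusCorr_shift`). -/
theorem tendsto_isingTorusTwoPoint_criticalTwoPoint (hd : 3 ≤ d) (p q : Site d) :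
    Tendsto (fun n : ℕ => isingTorusTwoPoint d (n + 1) (criticalBeta d) 0
        (Torus.proj (n + 1) p) (Torus.proj (n + 1) q)) atTop
      (𝓝 (criticalTwoPoint d (q - p))) := by
  by_cases hpq : p = q
  · subst hpq
    have h0 : criticalTwoPoint d (p - p) = 1 := by
      rw [sub_self]
      exact twoPointPlus_zero d _
    simp only [isingTorusTwoPoint, isingTwoPoint_self, h0]
    exact tendsto_const_nhds
  · have hβ : 0 ≤ criticalBeta d := criticalBeta_nonneg d
    have hm : spontaneousMagnetization d (criticalBeta d) = 0 :=
      spontaneousMagnetization_criticalBeta_eq_zero_holds (d := d) hd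
    have hqp : q - p ≠ 0 := sub_ne_zero.2 (Ne.symm hpq)
    have hmap : (({0, q - p} : Finset (Site d)).map (Site.shift p).toEmbedding) = {p, q} := by
      simp [Finset.map_insert]
    have hlim : plusCorr d (criticalBeta d) 0 {p, q} = criticalTwoPoint d (q - p) := by
      rw [criticalTwoPoint, twoPointPlus_eq_plusCorr _ hqp, ← hmap,
        plusCorr_shift d hβ le_rfl p _]
    rw [Metric.tendsto_atTop]
    intro ε hε
    obtain ⟨N₀, hN₀⟩ :=
      abs_isingTorusTwoPoint_sub_plusCorr_le_of_spontaneousMagnetization_eq_zero hβ hm hpq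
        (half_pos hε)
    refine ⟨N₀, fun n hn => ?_⟩
    rw [Real.dist_eq, ← hlim]
    have := hN₀ (n + 1) (by omega)
    linarith

/-- **The torus approximants are potential matrices, uniformly positive definite** (given IM):
for `β ≥ 0` and `A ⊂ ℤ^d` finite, once the torus `𝕋_{n+1}` is large enough for `Torus.proj` to be
injective on `A`, the matrix `(⟨σ_{p̄}σ_{q̄}⟩_{𝕋_{n+1};β})_{p,q ∈ A}` — a principal submatrix of the
torus two-point matrix — is a potential matrix (DMS Lemma 2.32, `principalSubmatrix_closure_holds`,
applied to `torus_isPotentialMatrix`), and its quadratic form dominates `e^{-4βd} c_p²`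
(finite energy, `torus_quadratic_lower_bound`). -/
theorem eventually_submatrix_isPotentialMatrix (hIM : InverseMFerromagnet) {β : ℝ} (hβ : 0 ≤ β)
    (A : Finset (Site d)) :
    ∃ n₀ : ℕ, ∀ n : ℕ, n₀ ≤ n →
      IsPotentialMatrix (Matrix.of fun p q : ↥A =>
          isingTorusTwoPoint d (n + 1) β 0 (Torus.proj (n + 1) p.1) (Torus.proj (n + 1) q.1)) ∧
        ∀ (c : ↥A → ℝ) (p : ↥A), Real.exp (-(2 * β * (2 * d : ℕ))) * c p ^ 2 ≤
          ∑ a, ∑ b, c a * c b *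
            isingTorusTwoPoint d (n + 1) β 0 (Torus.proj (n + 1) a.1) (Torus.proj (n + 1) b.1) := by
  obtain ⟨L₀, hL₀⟩ := exists_forall_subset_box d A
  refine ⟨2 * L₀, fun n hn => ?_⟩
  have hA : A ⊆ box d L₀ := hL₀ L₀ le_rfl
  -- the embedding of `A` into the torus `𝕋_{n+1}`
  have hinj : Function.Injective fun p : ↥A => Torus.proj (n + 1) p.1 := fun a b hab =>
    Subtype.ext (torusProj_injOn_box (M := L₀) (L := n + 1) (by omega) (hA a.2) (hA b.2) hab)
  let f : ↥A ↪ TorusSite d (n + 1) := ⟨fun p : ↥A => Torus.proj (n + 1) p.1, hinj⟩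
  set U : Matrix (TorusSite d (n + 1)) (TorusSite d (n + 1)) ℝ :=
    Matrix.of fun x y : TorusSite d (n + 1) => isingTorusTwoPoint d (n + 1) β 0 x y with hU
  have hsub : (Matrix.of fun p q : ↥A =>
      isingTorusTwoPoint d (n + 1) β 0 (Torus.proj (n + 1) p.1) (Torus.proj (n + 1) q.1)) =
      U.submatrix f f := by
    ext p q
    simp [hU, f]
  refine ⟨?_, fun c p => ?_⟩
  · rw [hsub]
    exact ((principalSubmatrix_closure_holds (TorusSite d (n + 1)) ↥A U f).2.1
      (torus_isPotentialMatrix hIM hβ)).1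
  · -- push `c` forward to the torus and use finite energy there
    have key := torus_quadratic_lower_bound (d := d) (N := n + 1) hβ
      (fun x => ∑ a : ↥A, if f a = x then c a else 0) (f p)
    rw [sum_ite_apply_eq_of_injective f.injective c p, sum_sum_fiber_mul] at key
    exact key

/-- Entrywise convergence of the torus approximants to the critical kernel, as matrices. -/
theorem tendsto_submatrix_criticalTwoPoint (hd : 3 ≤ d) (A : Finset (Site d)) :
    Tendsto (fun n : ℕ => (Matrix.of fun p q : ↥A =>
        isingTorusTwoPoint d (n + 1) (criticalBeta d) 0 (Torus.proj (n + 1) p.1)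
          (Torus.proj (n + 1) q.1))) atTop
      (𝓝 (Matrix.of fun p q : ↥A => criticalTwoPoint d (q.1 - p.1))) := by
  refine tendsto_pi_nhds.2 fun p => tendsto_pi_nhds.2 fun q => ?_
  exact tendsto_isingTorusTwoPoint_criticalTwoPoint hd p.1 q.1

/-- **The critical kernel restricted to a finite set is positive definite** (given IM, `d ≥ 3`):
symmetric as a limit of symmetric matrices, and `cᵀG_A c = lim cᵀG_A^{(n)}c ≥ e^{-4β_c d} c_p² > 0`
for `c_p ≠ 0` (uniform finite energy passes to the limit). -/
theorem posDef_criticalTwoPoint_submatrix (hd : 3 ≤ d) (hIM : InverseMFerromagnet)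
    (A : Finset (Site d)) :
    (Matrix.of fun p q : ↥A => criticalTwoPoint d (q.1 - p.1)).PosDef := by
  have hβ : 0 ≤ criticalBeta d := criticalBeta_nonneg d
  refine Matrix.PosDef.of_dotProduct_mulVec_pos ?_ fun c hc => ?_
  · refine Matrix.IsHermitian.ext fun i j => ?_
    simp only [Matrix.of_apply, star_trivial]
    refine tendsto_nhds_unique (tendsto_isingTorusTwoPoint_criticalTwoPoint hd j.1 i.1) ?_
    simp only [isingTorusTwoPoint_comm _ _ (Torus.proj _ j.1)]
    exact tendsto_isingTorusTwoPoint_criticalTwoPoint hd i.1 j.1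
  · obtain ⟨p, hp⟩ := Function.ne_iff.1 hc
    obtain ⟨n₀, hn₀⟩ := eventually_submatrix_isPotentialMatrix (d := d) hIM hβ A
    have hquad : c ⬝ᵥ ((Matrix.of fun p q : ↥A => criticalTwoPoint d (q.1 - p.1)) *ᵥ c) =
        ∑ a, ∑ b, c a * c b * criticalTwoPoint d (b.1 - a.1) := by
      simp only [dotProduct, Matrix.mulVec, Matrix.of_apply, Finset.mul_sum]
      refine Finset.sum_congr rfl fun x _ => Finset.sum_congr rfl fun y _ => ?_
      ring
    have hlim : Tendsto (fun n : ℕ => ∑ a, ∑ b, c a * c b *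
        isingTorusTwoPoint d (n + 1) (criticalBeta d) 0 (Torus.proj (n + 1) a.1)
          (Torus.proj (n + 1) b.1)) atTop (𝓝 (∑ a, ∑ b, c a * c b * criticalTwoPoint d (b.1 - a.1))) :=
      tendsto_finsetSum _ fun a _ => tendsto_finsetSum _ fun b _ =>
        (tendsto_isingTorusTwoPoint_criticalTwoPoint hd a.1 b.1).const_mul _
    have hge : Real.exp (-(2 * criticalBeta d * (2 * d : ℕ))) * c p ^ 2 ≤
        ∑ a, ∑ b, c a * c b * criticalTwoPoint d (b.1 - a.1) :=
      ge_of_tendsto hlim (Filter.eventually_atTop.2 ⟨n₀, fun n hn => (hn₀ n hn).2 c p⟩)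
    rw [star_trivial, hquad]
    refine lt_of_lt_of_le ?_ hge
    exact mul_pos (Real.exp_pos _) (lt_of_le_of_ne (sq_nonneg _) (Ne.symm (pow_ne_zero 2 hp)))

/-- **The inverses converge**: `(G_A^{(n)})⁻¹ → (G_A)⁻¹` entrywise, since `G_A^{(n)} → G_A` and
matrix inversion is continuous at the nonsingular (positive definite) limit `G_A`. -/
theorem tendsto_inv_submatrix_criticalTwoPoint (hd : 3 ≤ d) (hIM : InverseMFerromagnet)
    (A : Finset (Site d)) (u v : ↥A) :
    Tendsto (fun n : ℕ => (Matrix.of fun p q : ↥A =>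
        isingTorusTwoPoint d (n + 1) (criticalBeta d) 0 (Torus.proj (n + 1) p.1)
          (Torus.proj (n + 1) q.1))⁻¹ u v) atTop
      (𝓝 ((Matrix.of fun p q : ↥A => criticalTwoPoint d (q.1 - p.1))⁻¹ u v)) := by
  set G : Matrix ↥A ↥A ℝ := Matrix.of fun p q : ↥A => criticalTwoPoint d (q.1 - p.1) with hG
  have hdet : G.det ≠ 0 :=
    ((Matrix.isUnit_iff_isUnit_det G).1 (posDef_criticalTwoPoint_submatrix hd hIM A).isUnit).ne_zero
  have hcont : ContinuousAt Ring.inverse G.det := by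
    have := NormedRing.inverse_continuousAt (Units.mk0 _ hdet)
    simpa using this
  have hinv : Tendsto (fun n : ℕ => (Matrix.of fun p q : ↥A =>
      isingTorusTwoPoint d (n + 1) (criticalBeta d) 0 (Torus.proj (n + 1) p.1)
        (Torus.proj (n + 1) q.1))⁻¹) atTop (𝓝 G⁻¹) :=
    ((continuousAt_matrix_inv G hcont).tendsto).comp (tendsto_submatrix_criticalTwoPoint hd A)
  exact tendsto_pi_nhds.1 (tendsto_pi_nhds.1 hinv u) v

/-- **The critical kernel of `ℤ^d` (`d ≥ 3`) is a symmetric potential on every finite set, given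
IM.** For `A ⊂ ℤ^d` finite, `G_A = (⟨σ₀σ_{q-p}⟩⁺_{β_c})_{p,q ∈ A}` is positive definite, `G_A⁻¹` has
nonpositive off-diagonal entries and nonnegative row sums: the sign conditions hold for the torus
approximants (`eventually_submatrix_isPotentialMatrix`) and are closed under the entrywise limit of
the inverses (`tendsto_inv_submatrix_criticalTwoPoint`). -/
theorem criticalTwoPoint_isSymmetricPotential (hd : 3 ≤ d) (hIM : InverseMFerromagnet)
    (A : Finset (Site d)) :
    (Matrix.of fun p q : ↥A => criticalTwoPoint d (q.1 - p.1)).PosDef ∧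
      ∀ u v : ↥A, (u ≠ v → (Matrix.of fun p q : ↥A => criticalTwoPoint d (q.1 - p.1))⁻¹ u v ≤ 0) ∧
        0 ≤ ∑ w, (Matrix.of fun p q : ↥A => criticalTwoPoint d (q.1 - p.1))⁻¹ u w := by
  have hβ : 0 ≤ criticalBeta d := criticalBeta_nonneg d
  obtain ⟨n₀, hn₀⟩ := eventually_submatrix_isPotentialMatrix (d := d) hIM hβ A
  refine ⟨posDef_criticalTwoPoint_submatrix hd hIM A, fun u v => ⟨fun huv => ?_, ?_⟩⟩
  · refine le_of_tendsto (tendsto_inv_submatrix_criticalTwoPoint hd hIM A u v) ?_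
    exact Filter.eventually_atTop.2 ⟨n₀, fun n hn => (hn₀ n hn).1.1.2.2 u v huv⟩
  · refine ge_of_tendsto (tendsto_finsetSum _ fun w _ =>
      tendsto_inv_submatrix_criticalTwoPoint hd hIM A u w) ?_
    exact Filter.eventually_atTop.2 ⟨n₀, fun n hn => (hn₀ n hn).1.2 u⟩

/-- **Support item `InverseMCriticalKernel` of route `PrecisionLaplacian` (closure lemma, card M4):**
`InverseMFerromagnet →` the critical kernel of `ℤ³` is a symmetric potential on every finite set —
for `A ⊂ ℤ³` finite, `G_A := (criticalTwoPoint 3 (q - p))_{p,q ∈ A}` is positive definite and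
`(G_A)⁻¹` has nonpositive off-diagonal entries and nonnegative row sums. Proof: IM on the torus
`(ℤ/Nℤ)³` at `β_c` (zero field) gives a Z-matrix inverse; translation invariance gives
`(G_N)⁻¹𝟙 = 𝟙/χ_N ≥ 0`; finite energy gives uniform positive definiteness; principal submatrices
of potentials are potentials (Dellacherie–Martínez–San Martín 2014, Lemma 2.32); the torus
two-point function converges to `criticalTwoPoint` (`m*(β_c) = 0` in `d = 3`, Griffiths sandwich),
and the sign conditions pass to the limit of the inverses. -/
theorem InverseMCriticalKernel_proof : InverseMCriticalKernel := fun hIM A =>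
  criticalTwoPoint_isSymmetricPotential le_rfl hIM A

end Limit

end

end Summit.CriticalPhenomena.Ising3DConformalLimit.Theorems
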